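import Summits.BirchSwinnertonDyer.BirchSwinnertonDyer.Theorems.SignedLowerHalvesSprungLowerDivisibilityAtThreeKatoSporadicLedgerLambdaK1
import Summits.BirchSwinnertonDyer.BirchSwinnertonDyer.Theorems.SignedLowerHalvesSprungLowerDivisibilityAtThreeKatoFineLowerIff
import HarnessLib

/-!
# Crux K1 `SprungLowerDivisibilityAtThree` (stmt-BirchSwinnertonDyer-19875), line `chromatic-common-zeros`: on an X8 pair,
# Sprung's ♯/♭ Eisenstein divisibility for BOTH colours ⟺ the fine λ-BUDGET (socket β closed into an EQUIVALENCE)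
# (`--supports` 19875 as helper; closes nothing; K_spor / K1 / leaf X8 / BSD are NOT proved here)

Cell `bsd-ssimc`, width seat `cruxlead-…-19875-w2` (g7); last file of the sporadic ledger. `…KatoSporadicLedgerLambdaK1` (p652038) proved
«budget (frame-universal) ⟹ `SprungSharpFlatLowerDivisibility W 3 •` for either colour». Conversely, K1 for BOTH colours gives Kato's fine
inequality at EVERY height-one prime (the lead's frame `katoFineLower_of_lowerDivisibility`, p617250), hence the budget
(`SharpFlatColemanKatoData.zeta_lambdaInvariant_le_of_katoFineLower_offP`, p650879). So, per X8 pair and modulo the displayed named facts: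

  **`(∀ •, SprungSharpFlatLowerDivisibility W 3 •)  ⟺  (∀ frame, ∀ I, ∀ joint Cs/Cf, ∀ Y, λ(I.H ⧸ Cs.Z) ≤ λ(Y.X))`**

(`ClassX8.lowerDivisibility_iff_lambdaBudget`). Reading: crux K1 restricted to one pair is EXACTLY one integer inequality between the
ℤ₃-corank of the zeta index `𝐇¹/Z` and that of the fine Selmer dual `X₀(E/ℚ_∞)` — zeros counted, never located; `μ` plays no role on X8
(THEOREM B). HONEST FRAMING: an exact reformulation, not a weakening (STUB-PLAN β4); no engine supplies the budget class-wide at (3, ±3).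
CONDITIONAL on `h714`, `h716`, `h3`, `hJ` (displayed).

References: [Kato2004Asterisque] Conj. 12.10 (p. 224); [Sprung2012] Thm. 7.14, 7.16, Prop. 7.19, Main Conj. 7.21; [GreenbergVatsal2000] p. 4;
tree: `…KatoSporadicLedgerLambda` (p650544/p650879), `…LambdaK1` (p652038), `…KatoFineLowerIff` (p617250).
-/

set_option linter.dupNamespace false
set_option autoImplicit false

noncomputable section

open scoped Classical NumberField MatrixGroups ModularForm

open NumberField IsDedekindDomain CongruenceSubgroup WeierstrassCurve Field
  Literature.NumberTheory.EllipticCurves Literature.NumberTheory.EllipticCurves.ModularForms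
  Literature.NumberTheory.EllipticCurves.ZpExtension Literature.NumberTheory.EllipticCurves.Sprung2017
  Literature.NumberTheory.EllipticCurves.Sprung2012 Literature.NumberTheory.EllipticCurves.Rank1Residual
  Literature.NumberTheory.EllipticCurves.IwasawaAlgebra Literature.NumberTheory.EllipticCurves.Kato2004
  Literature.NumberTheory.EllipticCurves.Module
  Summit.BirchSwinnertonDyer.BirchSwinnertonDyer.Theorems
  Summit.BirchSwinnertonDyer.BirchSwinnertonDyer.Theorems.SmallImageSignedMuDefect

namespace Summit.BirchSwinnertonDyer.BirchSwinnertonDyer.Theorems.ChromaticCommonZeros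

/-- **K1 for both colours GIVES the budget.** On an X8 pair with `SprungSharpFlatLowerDivisibility W p •` for every colour `•`: for every
cyclotomic/Honda/newform frame, every Sprung pair, every pinned `I` with joint packages `Cs, Cf` (`Cs.Z = Cf.Z`) and every fine dual `Y`,
`lambdaInvariant p (I.H ⧸ Cs.Z) ≤ lambdaInvariant p Y.X`: K1 ⟹ KFL at every height-one prime (`katoFineLower_of_lowerDivisibility`), KFL off
`(3)` ⟹ budget (`zeta_lambdaInvariant_le_of_katoFineLower_offP` on the package of a non-zero colour). CONDITIONAL on `h714`, `h3`.
[cite: Kato2004Asterisque, Conj. 12.10 (p. 224)] [cite: Sprung2012, Prop. 6.14, Thm. 7.14 (p. 1504), Prop. 7.19 (p. 1505)] -/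
theorem ClassX8.lambdaBudget_of_lowerDivisibility (h714 : thm714_sharpFlatSelmerDual_finite_torsion)
    (h3 : realPeriodRat_eq_unit_mul_plusPeriod_three)
    (W : WeierstrassCurve ℚ) [W.IsElliptic] [W.IsGloballyMinimal] (p : ℕ) [Fact p.Prime]
    [ContinuousSMul ℤ_[p] (W.tateModule p)] [Module.Free ℤ_[p] (W.tateModule p)]
    [Module.Finite ℤ_[p] (W.tateModule p)]
    (hX : ClassX8 W p) (hK1 : ∀ col : Chroma, SprungSharpFlatLowerDivisibility W p col)
    (κ : ZpExtension ℚ p) (γ : Field.absoluteGaloisGroup ℚ)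
    (hκ : κ.IsCyclotomic) (hγ : κ.IsTopGenerator γ) (hcv : IsCyclotomicVariable p γ)
    (v : HeightOneSpectrum (𝓞 ℚ)) (hv : (p : 𝓞 ℚ) ∈ v.asIdeal)
    (g : Field.absoluteGaloisGroup (v.adicCompletion ℚ))
    (hg : κ.IsTopGenerator (resGalOfEmb (closureEmb (K := ℚ) (v.adicCompletion ℚ)) g))
    (cneg : localPoints W (v.adicCompletion ℚ)) (c : ℕ → localPoints W (v.adicCompletion ℚ))
    (hH : IsHondaSystem κ (closureEmb (K := ℚ) (v.adicCompletion ℚ)) W (W.frobeniusTrace p) g cneg c)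
    (N : ℕ) (hN : NeZero N) (f : CuspForm (Gamma0 N) 2) (ϖ : ℚ) (Lsharp Lflat : IwasawaAlgebra p)
    (hf : IsNewformOf W f) (hϖ : (ϖ : ℝ) * W.realPeriodRat = plusPeriod f)
    (hSP : IsSprungPair f p (W.frobeniusTrace p) Lsharp Lflat)
    (I : Kato2004.IwasawaH1Data W p κ γ)
    (Cs : SharpFlatColemanKatoData W p f ϖ κ γ (closureEmb (K := ℚ) (v.adicCompletion ℚ)) (W.frobeniusTrace p) g c
      Chroma.sharp I)
    (Cf : SharpFlatColemanKatoData W p f ϖ κ γ (closureEmb (K := ℚ) (v.adicCompletion ℚ)) (W.frobeniusTrace p) g c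
      Chroma.flat I)
    (hZ : Cs.Z = Cf.Z) (Y : W.FineSelmerDualData κ γ) :
    lambdaInvariant p (I.H ⧸ Cs.Z) ≤ lambdaInvariant p Y.X := by
  haveI : NeZero N := hN
  have hX' := hX
  obtain ⟨hp3, ⟨hgood, hap⟩, -⟩ := id hX
  subst hp3
  have hp2 : (3 : ℕ) ≠ 2 := by decide
  have hirr : W.HasIrreducibleModPGaloisRep 3 :=
    hasIrreducibleModPGaloisRep_of_dvd_frobeniusTrace W 3 hp2
      (W.not_dvd_minimalDiscriminantInt_of_hasGoodReductionAtPrime' 3 hgood) hap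
  have hϖ0 : ϖ ≠ 0 := hf.periodRatio_ne_zero hϖ
  -- KFL at every height-one prime from K1 for both colours
  have hKFL : ∀ 𝔭 : PrimeSpectrum (IwasawaAlgebra 3), 𝔭.asIdeal.height = 1 →
      Module.lengthAt (IwasawaAlgebra 3) (I.H ⧸ Cs.Z) 𝔭 ≤ Module.lengthAt (IwasawaAlgebra 3) Y.X 𝔭 :=
    fun 𝔭 h𝔭 => katoFineLower_of_lowerDivisibility h714 h3 W 3 hX' hK1 κ γ hκ hγ hcv v hv g hg cneg c hH N hN f ϖ Lsharp Lflat
      hf hϖ hSP I Cs Cf hZ Y 𝔭 h𝔭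
  obtain ⟨hGall, -⟩ := stub_periodMu h3 W 3 hX' N hN f ϖ Lsharp Lflat hf hϖ hSP
  -- the budget on the package of a non-zero colour
  have key : ∀ (c₀ : Chroma), chromaticL c₀ Lsharp Lflat ≠ 0 →
      ∀ (C : SharpFlatColemanKatoData W 3 f ϖ κ γ (closureEmb (K := ℚ) (v.adicCompletion ℚ))
        (W.frobeniusTrace 3) g c c₀ I), C.Z = Cs.Z →
      lambdaInvariant 3 (I.H ⧸ Cs.Z) ≤ lambdaInvariant 3 Y.X := by
    intro c₀ hc₀ C hZ₀
    obtain ⟨G, hG⟩ := hGall c₀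
    have hG0 : G ≠ 0 := by
      intro h0
      rw [h0, map_zero, eq_comm, mul_eq_zero] at hG
      rcases hG with hC | hL
      · have h1 : ((ϖ : ℚ) : ℚ_[3]) = 0 := by simpa using congrArg PowerSeries.constantCoeff hC
        exact hϖ0 (by exact_mod_cast h1)
      · exact hc₀ (iwasawaToPowerSeries_injective 3 (by rw [hL, map_zero]))
    obtain ⟨D⟩ := nonempty_sharpFlatSelmerDualData_rat W κ γ v g c c₀
    obtain ⟨hfin, hXt⟩ := h714 W 3 hp2 hgood hap f hf κ γ hκ hγ hcv v hv g hg cneg c hH c₀ Lsharp Lflat hSP hc₀ D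
    haveI := hfin
    have hb := C.zeta_lambdaInvariant_le_of_katoFineLower_offP W 3 hirr hSP hc₀ hG hG0 D hXt Y
      (fun 𝔭 h𝔭 _ => by rw [hZ₀]; exact hKFL 𝔭 h𝔭)
    rwa [hZ₀] at hb
  rcases IsSprungPair.ne_zero_or_ne_zero hf hgood hSP with hs | hfl
  · exact key Chroma.sharp hs Cs rfl
  · exact key Chroma.flat hfl Cf hZ.symm

/-- **K1 ON AN X8 PAIR ⟺ THE FINE λ-BUDGET.** For `W` of class X8 at `p` (= 3): Sprung's ♯/♭ Eisenstein divisibility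
`SprungSharpFlatLowerDivisibility W p •` for BOTH colours holds iff for every cyclotomic/Honda/newform frame, every pinned `I`, every joint
♯/♭ package pair `Cs, Cf` (`Cs.Z = Cf.Z`) and every fine dual `Y`: `lambdaInvariant p (I.H ⧸ Cs.Z) ≤ lambdaInvariant p Y.X`. (⟸):
`ClassX8.sprungSharpFlatLowerDivisibility_of_lambdaBudget`; (⟹): `ClassX8.lambdaBudget_of_lowerDivisibility` with a Sprung pair from
`thm112_exists_isSprungPair_holds`. CONDITIONAL on `h714`, `h716`, `h3`, `hJ` (displayed). Nothing here supplies either side for any curve.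
[cite: Sprung2012, Main Conj. 7.21 and Prop. 7.19 (p. 1505)] [cite: Kato2004Asterisque, Conj. 12.10 (p. 224)] [cite: GreenbergVatsal2000, p. 4] -/
theorem ClassX8.lowerDivisibility_iff_lambdaBudget (h714 : thm714_sharpFlatSelmerDual_finite_torsion)
    (h716 : thm716_sharpFlatCharIdeal_divisibility) (h3 : realPeriodRat_eq_unit_mul_plusPeriod_three)
    (hJ : thm714seq_sharpFlatColemanKato_zetaJoint)
    (W : WeierstrassCurve ℚ) [W.IsElliptic] [W.IsGloballyMinimal] (p : ℕ) [Fact p.Prime] (hX : ClassX8 W p) :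
    (∀ col : Chroma, SprungSharpFlatLowerDivisibility W p col) ↔
      ∀ [ContinuousSMul ℤ_[p] (W.tateModule p)] [Module.Free ℤ_[p] (W.tateModule p)]
        [Module.Finite ℤ_[p] (W.tateModule p)] (κ : ZpExtension ℚ p) (γ : Field.absoluteGaloisGroup ℚ),
        κ.IsCyclotomic → κ.IsTopGenerator γ → IsCyclotomicVariable p γ →
      ∀ (v : HeightOneSpectrum (𝓞 ℚ)), (p : 𝓞 ℚ) ∈ v.asIdeal →
      ∀ (g : Field.absoluteGaloisGroup (v.adicCompletion ℚ)),
        κ.IsTopGenerator (resGalOfEmb (closureEmb (K := ℚ) (v.adicCompletion ℚ)) g) →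
      ∀ (cneg : localPoints W (v.adicCompletion ℚ)) (c : ℕ → localPoints W (v.adicCompletion ℚ)),
        IsHondaSystem κ (closureEmb (K := ℚ) (v.adicCompletion ℚ)) W (W.frobeniusTrace p) g cneg c →
      ∀ (N : ℕ) (_ : NeZero N) (f : CuspForm (Gamma0 N) 2) (ϖ : ℚ),
        IsNewformOf W f → (ϖ : ℝ) * W.realPeriodRat = plusPeriod f →
      ∀ (I : Kato2004.IwasawaH1Data W p κ γ)
        (Cs : SharpFlatColemanKatoData W p f ϖ κ γ (closureEmb (K := ℚ) (v.adicCompletion ℚ)) (W.frobeniusTrace p) g c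
          Chroma.sharp I)
        (Cf : SharpFlatColemanKatoData W p f ϖ κ γ (closureEmb (K := ℚ) (v.adicCompletion ℚ)) (W.frobeniusTrace p) g c
          Chroma.flat I),
        Cs.Z = Cf.Z → ∀ (Y : W.FineSelmerDualData κ γ),
        lambdaInvariant p (I.H ⧸ Cs.Z) ≤ lambdaInvariant p Y.X := by
  constructor
  · intro hK1 _ _ _ κ γ hκ hγ hcv v hv g hg cneg c hH N hN f ϖ hf hϖ I Cs Cf hZ Y
    haveI : NeZero N := hN
    obtain ⟨hp3, ⟨hgood, hap⟩, -⟩ := id hX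
    have hp2 : p ≠ 2 := by rw [hp3]; decide
    obtain ⟨Lsharp, Lflat, hSP⟩ := thm112_exists_isSprungPair_holds (W := W) (f := f) (p := p) hp2 hf (hp3 ▸ hgood) (hp3 ▸ hap)
    exact ClassX8.lambdaBudget_of_lowerDivisibility h714 h3 W p hX hK1 κ γ hκ hγ hcv v hv g hg cneg c hH N hN f ϖ Lsharp Lflat
      hf hϖ hSP I Cs Cf hZ Y
  · intro hb col
    exact ClassX8.sprungSharpFlatLowerDivisibility_of_lambdaBudget h714 h716 h3 hJ W p hX col
      fun κ γ hκ hγ hcv v hv g hg cneg c hH N hN f ϖ hf hϖ I Cs Cf hZ Y =>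
        hb κ γ hκ hγ hcv v hv g hg cneg c hH N hN f ϖ hf hϖ I Cs Cf hZ Y

end Summit.BirchSwinnertonDyer.BirchSwinnertonDyer.Theorems.ChromaticCommonZeros

end
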